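import Summits.ABC.ABC.Theses.IneffectiveSubspace

/-!
# `UniformSadicTowerFour` (stmt-ABC-14937), line `flat-steep-split` (lead c5): the TWO-LOG axis
# UPD⁺(1,2) at the single FIXED modulus `p = 2` is already of Wieferich type

Lead c4/c5's normal form of the first open rung `W = 3` of the crux's necessary condition
BoundedOmegaABC is the ONE-PRIME / TWO-BASE divisibility bound UPD(1,2), which splits
(`…ThreeSlotTwoLog.lean`) into its ONE-LOG axis UPD(1,1) and its **two-log part UPD⁺(1,2)**: for
every `ε > 0` there is `C` such that for pairwise distinct primes `p, q, r`, exponents `Y, Z ≥ 1`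
and `t ∈ ℕ`, `p^t ∣ q^Y r^Z − 1` (with `q^Y r^Z ≥ 2`) or `p^t ∣ r^Z − q^Y` (with `q^Y < r^Z`)
implies `p^t ≤ C · (pqr)^(1+ε) · (q^Y r^Z)^ε`.  UPD⁺(1,2) is OPEN (abc-type) and appears here only
inlined, as a hypothesis.

Per FIXED modulus `p` the one-log axis is a theorem of Ridout type (sibling file
`…OneLogRidout.lean`), and per fixed TRIPLE `(p, q, r)` all of UPD is Yu's theorem
(`…OnePrimeYuWall.lean`).  This file records that the two-log axis at the single fixed modulus
`p = 2` already contains a statement of Wieferich type, so that the passage from one to two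
logarithms (rank `1` → rank `2` of the approximating group `⟨q, r⟩`) is exactly where the tree's
engines stop:

* `fermatPlusOne_sq_of_onePrimeTwoBasePos` — UPD⁺(1,2) ⟹ for every `ε > 0` there is `C` with
  `q ≤ C · 2^(ε t)` whenever `2^t + 1 = q² · r^Z` with `q ≠ r` odd primes and `Z ≥ 1`: in any such
  factorisation the SQUARE base `q` is sub-exponentially small in `t`;
* `isWieferich_two_of_sq_dvd_two_pow_add_one` — the candidates are Wieferich primes: an odd prime
  `q` with `q² ∣ 2^t + 1` and `q ∤ 2t` satisfies `2^(q−1) ≡ 1 (mod q²)`, i.e. `IsWieferich 2 q`.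
  So in a family violating the conclusion of the first theorem (`q > C 2^(εt)`, i.e.
  `t < ε⁻¹ log₂ q`, whence `q ∤ 2t` for large `q`) every `q` is a base-`2` Wieferich prime whose
  multiplicative order `ord_q(2) ∣ 2t` is `O(log q)`; no unconditional argument excluding such a
  family is available in the tree (already the squarefreeness of the numbers `2^t + 1` is open).

**Proofs.** (1) Fix `ε`, put `δ := ε/2` and take `C_δ` from UPD⁺(1,2).  Given `2^t + 1 = q² r^Z`
apply it at `p := 2`, bases `q, r`, `Y := 2`, first alternative (`q² r^Z − 1 = 2^t`,
`q² r^Z ≥ 2`): `2^t ≤ C_δ (2qr)^(1+δ) (q² r^Z)^δ`.  With `T := 2^t`: `q² r^Z = T + 1 ≤ 2T` and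
`(2qr) · q = 2 q² r ≤ 2 q² r^Z ≤ 4T` (`r ≤ r^Z`), so, multiplying by `q^(1+δ)`,
`q^(1+δ) T ≤ C_δ (2qr · q)^(1+δ) (2T)^δ ≤ C_δ (4T)^(1+δ) (2T)^δ = C_δ 4^(1+δ) 2^δ · T^(2δ) · T`,
i.e. `q ≤ q^(1+δ) ≤ C_δ 4^(1+δ) 2^δ · 2^(2δt) = C · 2^(εt)` (`twoLogFixed_real`).
(2) In `ZMod q²`: `2^t = −1`, so `2^(2t) = 1` and the order `D` of `2` divides `2t`; by Euler
(`Nat.ModEq.pow_totient`, `Nat.totient_prime_pow`) `D ∣ φ(q²) = q(q−1)`; `q ∤ D` (else `q ∣ 2t`),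
so `D` is prime to `q` and `D ∣ q − 1`, i.e. `2^(q−1) = 1` in `ZMod q²`.

Sources: the crux notes of the line `flat-steep-split` (`Cruxes/UniformSadicTowerFour/`, lead c5);
the arguments are elementary [folklore]; the base-`2` Wieferich condition [cite: Wieferich1909]
enters only through the tree's definition `IsWieferich`
(`Literature/NumberTheory/DiophantineGeometry/AbcWave0.lean`).  Mathlib only (`Real.mul_rpow`,
`Real.rpow_add`, `Real.rpow_mul`, `Real.rpow_natCast`, `Real.rpow_le_rpow`,
`Real.self_le_rpow_of_one_le`, `orderOf_dvd_of_pow_eq_one`, `orderOf_dvd_iff_pow_eq_one`,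
`Nat.ModEq.pow_totient`, `Nat.totient_prime_pow`, `ZMod.natCast_eq_natCast_iff`,
`ZMod.natCast_eq_zero_iff`).  No new definitions.  Deliberately NOT here: UPD⁺(1,2) itself (OPEN:
hypothesis only), the splitting UPD ⟺ UPD⁺ ∧ UPD(1,1) and `B₃ ⟸ UPD⁺` (`…ThreeSlotTwoLog.lean`),
the one-log axis at a fixed modulus (`…OneLogRidout.lean`, `…OneLogSmallOrder.lean`).
-/

noncomputable section

-- `Summit.<Summit>.<Problem>` is the mandated summit-side namespace (CONVENTIONS §2); for the
-- single-conjunct summit `ABC` the two coincide, so the duplicate `ABC.ABC` is deliberate.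
set_option linter.dupNamespace false

namespace Summit.ABC.ABC.Theorems.UniformSadicTowerFour.BoundedOmega

open Literature.NumberTheory.DiophantineGeometry (IsWieferich)

/-! ## Real-analysis bookkeeping -/

/-- The real step.  Let `δ, K, T > 0`, `q ≥ 1`, `M, X ≥ 0` in `ℝ` with `M · q ≤ 4T`, `X ≤ 2T` and
`T ≤ K · M^(1+δ) · X^δ`.  Multiplying by `q^(1+δ)`:
`q^(1+δ) T ≤ K (Mq)^(1+δ) X^δ ≤ K (4T)^(1+δ) (2T)^δ = (K 4^(1+δ) 2^δ T^(2δ)) · T`, so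
`q ≤ q^(1+δ) ≤ K 4^(1+δ) 2^δ T^(2δ)`. [folklore] -/
private theorem twoLogFixed_real {q M X T K δ : ℝ} (hδ : 0 < δ) (hK : 0 < K) (hq : 1 ≤ q)
    (hT : 0 < T) (hM : 0 ≤ M) (hX : 0 ≤ X) (hMq : M * q ≤ 4 * T) (hXT : X ≤ 2 * T)
    (h : T ≤ K * M ^ (1 + δ) * X ^ δ) :
    q ≤ K * 4 ^ (1 + δ) * 2 ^ δ * T ^ (2 * δ) := by
  have hq0 : 0 < q := one_pos.trans_le hq
  have hδ1 : (0 : ℝ) ≤ 1 + δ := by linarith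
  have h1 : q ^ (1 + δ) * T ≤ K * 4 ^ (1 + δ) * 2 ^ δ * T ^ (2 * δ) * T := by
    calc q ^ (1 + δ) * T ≤ q ^ (1 + δ) * (K * M ^ (1 + δ) * X ^ δ) :=
          mul_le_mul_of_nonneg_left h (Real.rpow_nonneg hq0.le _)
      _ = K * (M * q) ^ (1 + δ) * X ^ δ := by rw [Real.mul_rpow hM hq0.le]; ring
      _ ≤ K * (4 * T) ^ (1 + δ) * (2 * T) ^ δ :=
          mul_le_mul
            (mul_le_mul_of_nonneg_left
              (Real.rpow_le_rpow (mul_nonneg hM hq0.le) hMq hδ1) hK.le)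
            (Real.rpow_le_rpow hX hXT hδ.le) (Real.rpow_nonneg hX _)
            (mul_nonneg hK.le (Real.rpow_nonneg (by positivity) _))
      _ = K * 4 ^ (1 + δ) * 2 ^ δ * T ^ (2 * δ) * T := by
          rw [Real.mul_rpow (by norm_num) hT.le, Real.mul_rpow (by norm_num) hT.le,
            Real.rpow_add hT, Real.rpow_one, two_mul, Real.rpow_add hT]
          ring
  calc q ≤ q ^ (1 + δ) := Real.self_le_rpow_of_one_le hq (by linarith)
    _ ≤ K * 4 ^ (1 + δ) * 2 ^ δ * T ^ (2 * δ) := le_of_mul_le_mul_right h1 hT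

/-! ## UPD⁺(1,2) at the fixed modulus `2`: the square base of `2^t + 1 = q² r^Z` is small -/

/-- **UPD⁺(1,2) ⟹ `2^t + 1 = q² · r^Z` forces `q ≤ C_ε · 2^(εt)`.**  For every `ε > 0` there is
`C` such that for odd primes `q ≠ r`, `Z ≥ 1` and `t` with `2^t + 1 = q² r^Z` the square base
satisfies `q ≤ C · 2^(ε t)`.  Proof: UPD⁺(1,2) with `δ = ε/2` at `p = 2`, `Y = 2`, first
alternative (`q² r^Z − 1 = 2^t ≥ 1`), then `twoLogFixed_real` with `T = 2^t`, `M = 2qr`,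
`X = q² r^Z` (`X = T + 1 ≤ 2T`, `M q = 2q²r ≤ 2 q² r^Z ≤ 4T`) and `(2^t)^(2δ) = 2^(εt)`; the
constant is `C = C_δ · 4^(1+δ) · 2^δ`.  A hardness certificate for the two-log axis: by
`isWieferich_two_of_sq_dvd_two_pow_add_one` a violating family consists of base-`2` Wieferich
primes of multiplicative order `O(log q)`. [folklore] -/
theorem fermatPlusOne_sq_of_onePrimeTwoBasePos
    (hU : ∀ ε : ℝ, 0 < ε → ∃ C : ℝ, 0 < C ∧ ∀ p q r : ℕ, p.Prime → q.Prime → r.Prime → p ≠ q →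
      p ≠ r → q ≠ r → ∀ Y Z t : ℕ, 1 ≤ Y → 1 ≤ Z →
        (p ^ t ∣ q ^ Y * r ^ Z - 1 ∧ 2 ≤ q ^ Y * r ^ Z) ∨ (p ^ t ∣ r ^ Z - q ^ Y ∧ q ^ Y < r ^ Z) →
        ((p ^ t : ℕ) : ℝ) ≤ C * ((p * q * r : ℕ) : ℝ) ^ (1 + ε) * ((q ^ Y * r ^ Z : ℕ) : ℝ) ^ ε) :
    ∀ ε : ℝ, 0 < ε → ∃ C : ℝ, 0 < C ∧ ∀ q r t Z : ℕ, q.Prime → r.Prime → q ≠ r → q ≠ 2 → r ≠ 2 →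
      1 ≤ Z → 2 ^ t + 1 = q ^ 2 * r ^ Z → (q : ℝ) ≤ C * (2 : ℝ) ^ (ε * t) := by
  intro ε hε
  obtain ⟨K, hK, H⟩ := hU (ε / 2) (half_pos hε)
  refine ⟨K * 4 ^ (1 + ε / 2) * 2 ^ (ε / 2), by positivity, ?_⟩
  intro q r t Z hq hr hqr hq2 hr2 hZ h
  have ht1 : 1 ≤ 2 ^ t := Nat.one_le_two_pow
  -- UPD⁺(1,2) at `p = 2`, `Y = 2`, first alternative: `q² r^Z − 1 = 2^t`, `q² r^Z ≥ 2`
  have hsub : q ^ 2 * r ^ Z - 1 = 2 ^ t := by rw [← h, Nat.add_sub_cancel]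
  have h2le : 2 ≤ q ^ 2 * r ^ Z := by rw [← h]; omega
  have key := H 2 q r Nat.prime_two hq hr (Ne.symm hq2) (Ne.symm hr2) hqr 2 Z t (by norm_num) hZ
    (Or.inl ⟨hsub ▸ dvd_rfl, h2le⟩)
  -- sizes: `q² r^Z = 2^t + 1 ≤ 2 · 2^t` and `(2qr) · q = 2 q² r ≤ 2 q² r^Z ≤ 4 · 2^t`
  have hX : ((q ^ 2 * r ^ Z : ℕ) : ℝ) ≤ 2 * (2 : ℝ) ^ t := by
    have hn : q ^ 2 * r ^ Z ≤ 2 * 2 ^ t := by rw [← h]; omega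
    exact_mod_cast hn
  have hM : ((2 * q * r : ℕ) : ℝ) * q ≤ 4 * (2 : ℝ) ^ t := by
    have hrZ : r ≤ r ^ Z := Nat.le_self_pow (by omega) r
    have h1 : 2 * q * r * q ≤ 2 * (q ^ 2 * r ^ Z) := by
      calc 2 * q * r * q = 2 * (q ^ 2 * r) := by ring
        _ ≤ 2 * (q ^ 2 * r ^ Z) := Nat.mul_le_mul_left _ (Nat.mul_le_mul_left _ hrZ)
    have hn : 2 * q * r * q ≤ 4 * 2 ^ t := by rw [← h] at h1; omega
    exact_mod_cast hn
  have hT : ((2 ^ t : ℕ) : ℝ) = (2 : ℝ) ^ t := by push_cast; ring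
  rw [hT] at key
  have hq1 : (1 : ℝ) ≤ q := by exact_mod_cast hq.one_lt.le
  have hfin := twoLogFixed_real (half_pos hε) hK hq1 (by positivity) (by positivity)
    (by positivity) hM hX key
  -- `(2^t)^(2 · ε/2) = 2^(ε t)`
  have hexp : ((2 : ℝ) ^ t) ^ (2 * (ε / 2)) = (2 : ℝ) ^ (ε * t) := by
    rw [← Real.rpow_natCast, ← Real.rpow_mul (by norm_num : (0 : ℝ) ≤ 2)]
    congr 1
    ring
  rw [hexp] at hfin
  exact hfin

/-! ## Square divisors of `2^t + 1` are Wieferich -/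

/-- **Odd square divisors of `2^t + 1` are base-`2` Wieferich primes.**  If `q` is an odd prime
with `q² ∣ 2^t + 1` and `q ∤ 2t`, then `2^(q−1) ≡ 1 (mod q²)`, i.e. `IsWieferich 2 q`.  Proof: in
`ZMod q²`, `2^t = −1`, so `2^(2t) = 1` and the order `D` of `2` divides `2t`; by Euler
`2^φ(q²) = 1` with `φ(q²) = q (q − 1)`, so `D ∣ q (q − 1)`; `q ∤ D` (else `q ∣ 2t`), hence `D` is
prime to `q`, `D ∣ q − 1` and `2^(q−1) = 1`.  (For the exceptional `q ∣ 2t`, i.e. `q ∣ t`, one has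
`t ≥ q`, which is harmless for `fermatPlusOne_sq_of_onePrimeTwoBasePos`.) [folklore] -/
theorem isWieferich_two_of_sq_dvd_two_pow_add_one {q t : ℕ} (hq : q.Prime) (hq2 : q ≠ 2)
    (h : q ^ 2 ∣ 2 ^ t + 1) (hqt : ¬ q ∣ 2 * t) : IsWieferich 2 q := by
  -- in `ZMod q²`: `2^t = -1`, so `2^(2t) = 1`
  have h1 : (2 : ZMod (q ^ 2)) ^ (2 * t) = 1 := by
    have h0 : ((2 ^ t + 1 : ℕ) : ZMod (q ^ 2)) = 0 := (ZMod.natCast_eq_zero_iff _ _).2 h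
    push_cast at h0
    rw [pow_mul', eq_neg_of_add_eq_zero_left h0, neg_one_sq]
  -- Euler: `2^(q (q - 1)) = 2^φ(q²) = 1`
  have hcop : Nat.Coprime 2 (q ^ 2) :=
    Nat.Coprime.pow_right 2 ((Nat.coprime_primes Nat.prime_two hq).2 (Ne.symm hq2))
  have hφ : Nat.totient (q ^ 2) = q * (q - 1) := by
    rw [Nat.totient_prime_pow hq two_pos]
    simp
  have h2 : (2 : ZMod (q ^ 2)) ^ (q * (q - 1)) = 1 := by
    have h0 := (ZMod.natCast_eq_natCast_iff _ _ _).2 (Nat.ModEq.pow_totient hcop)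
    rw [hφ] at h0
    push_cast at h0
    exact h0
  -- the order `D` of `2` divides `2t` and `q (q - 1)` and is prime to `q`, so `D ∣ q - 1`
  have hD2t : orderOf (2 : ZMod (q ^ 2)) ∣ 2 * t := orderOf_dvd_of_pow_eq_one h1
  have hDφ : orderOf (2 : ZMod (q ^ 2)) ∣ q * (q - 1) := orderOf_dvd_of_pow_eq_one h2
  have hDq : Nat.Coprime (orderOf (2 : ZMod (q ^ 2))) q :=
    Nat.coprime_comm.1 ((Nat.Prime.coprime_iff_not_dvd hq).2 fun hd => hqt (hd.trans hD2t))
  have hD : orderOf (2 : ZMod (q ^ 2)) ∣ q - 1 := hDq.dvd_of_dvd_mul_left hDφ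
  -- hence `2^(q-1) = 1` in `ZMod q²`
  have h3 : (2 : ZMod (q ^ 2)) ^ (q - 1) = 1 := orderOf_dvd_iff_pow_eq_one.1 hD
  have h4 : ((2 ^ (q - 1) : ℕ) : ZMod (q ^ 2)) = ((1 : ℕ) : ZMod (q ^ 2)) := by
    push_cast
    exact h3
  show 2 ^ (q - 1) ≡ 1 [MOD q ^ 2]
  exact (ZMod.natCast_eq_natCast_iff _ _ _).1 h4

end Summit.ABC.ABC.Theorems.UniformSadicTowerFour.BoundedOmega

end
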